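import Summits.ResolutionOfSingularities.ResolutionOfSingularities.Theses.WildCones

/-!
# `ConeExit` (crux stmt-ResolutionOfSingularities-16883, route `WildCones`): exact mirror of the
# crux's `let`-calculus and a kernel-checkable certificate format for `Isol`
# (negative-side support, refuter cdisprove seat; this file refutes nothing)

The crux `ConeExit` is stated over a `let`-bound coefficient calculus (clean / blow up / divide /
translate / clean; Jacobian ideal of the cleaned series; `Isol` = `κ[[u]] ⧸ (∂a)` finite over `κ`).
Negative lemmas about its load-bearing hypotheses (`Negative/FalseWithoutN3.lean`, …) need to EVALUATE
that calculus on explicit states and to CERTIFY isolatedness in the kernel. This file provides: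

* the operators mirrored verbatim as `def`s (token for token, as in the registered skeleton
  `Cruxes/ConeExit/Lines/critical_plane.lean`) and `crux_iff : ConeExit ↔ … := Iff.rfl`, certifying
  that the mirror is EXACT (the three predicates `Isol`, `MultP`, `OrdP` are displayed inline);
* `tr_zero` (translation by `τ = 0` is the identity) and the coefficient formulas `coeff_ser`,
  `coeff_pd_ser`;
* `module_finite_quotient_of_X_pow_mem`: if every `X_k ^ N` lies in an ideal `J ⊆ κ[[X₁ … Xₙ]]` then
  `κ[[X]] ⧸ J` is module-finite over `κ` (spanned by the `N ^ n` small monomials) — so an `Isol`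
  claim is certified by `n` explicit memberships `X_k ^ N ∈ (∂₁a, …, ∂ₙa)`.
-/

noncomputable section

-- single-problem summit: the doubled namespace component `ResolutionOfSingularities` is forced by the tree layout
set_option linter.dupNamespace false

namespace Summit.ResolutionOfSingularities.ResolutionOfSingularities.Theorems.ConeExit.Negative

open Summit.ResolutionOfSingularities.ResolutionOfSingularities.Theses.WildCones (ConeExit)
open scoped BigOperators Classical

/-! ## The crux's calculus, mirrored verbatim as `def`s (identical to `Lines/critical_plane.lean`) -/

section Calculus

variable {n : ℕ} {κ : Type} [Field κ] (p : ℕ)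

/-- CLEANING: delete the p-th-power monomials. Mirror of the crux's `clean`. [cite: HauserPerlega2019, §1] -/
def clean (c : (Fin n → ℕ) → κ) : (Fin n → ℕ) → κ :=
  fun A => @ite κ (∀ j, p ∣ A j) (Classical.dec _) 0 (c A)

/-- BLOW-UP of the origin, chart `uᵢ`. Mirror of the crux's `bl`. [cite: Kollar2007, Ch. 3] -/
def bl (i : Fin n) (c : (Fin n → ℕ) → κ) : (Fin n → ℕ) → κ :=
  fun B => @ite κ (Finset.sum (Finset.univ.erase i) (fun j => B j) ≤ B i) (Classical.dec _) (c (Function.update B i (B i - Finset.sum (Finset.univ.erase i) (fun j => B j)))) 0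

/-- ORDER of a coefficient function. Mirror of the crux's `ord`. [folklore] -/
def ord (c : (Fin n → ℕ) → κ) : ℕ :=
  sInf {m : ℕ | ∃ A, c A ≠ 0 ∧ m = Finset.sum Finset.univ (fun j => A j)}

/-- DIVISION by `uᵢ^s`. Mirror of the crux's `dv`. [folklore] -/
def dv (i : Fin n) (s : ℕ) (c : (Fin n → ℕ) → κ) : (Fin n → ℕ) → κ :=
  fun B => c (Function.update B i (B i + s))

/-- TRANSLATION `u_j ↦ u_j + τ_j` for `j ≠ i`. Mirror of the crux's `tr`. [folklore] -/
def tr (i : Fin n) (τ : Fin n → κ) (s : ℕ) (c : (Fin n → ℕ) → κ) : (Fin n → ℕ) → κ :=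
  fun B => Finset.sum (Fintype.piFinset (fun _ : Fin n => Finset.range (B i + s + 1))) (fun D => @ite κ (D i = 0) (Classical.dec _) (c (B + D) * Finset.prod (Finset.univ.erase i) (fun j => ((Nat.choose (B j + D j) (B j) : ℕ) : κ) * τ j ^ (D j))) 0)

/-- ONE STEP of the point-blow-up dynamics. Mirror of the crux's `step`. [cite: HauserPerlega2019, §1] -/
def step (i : Fin n) (τ : Fin n → κ) (c : (Fin n → ℕ) → κ) : (Fin n → ℕ) → κ :=
  clean p (tr i τ (@ite ℕ (p ≤ ord (clean p c)) (Classical.dec _) p 0) (dv i (@ite ℕ (p ≤ ord (clean p c)) (Classical.dec _) p 0) (bl i (clean p c))))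

/-- The cleaned state as a formal power series. Mirror of the crux's `ser`. [folklore] -/
def ser (c : (Fin n → ℕ) → κ) : MvPowerSeries (Fin n) κ :=
  show MvPowerSeries (Fin n) κ from fun A : Fin n →₀ ℕ => clean p c ⇑A

/-- Formal partial derivative `∂/∂uᵢ`. Mirror of the crux's `pd`. [folklore] -/
def pd (i : Fin n) (f : MvPowerSeries (Fin n) κ) : MvPowerSeries (Fin n) κ :=
  show MvPowerSeries (Fin n) κ from fun A : Fin n →₀ ℕ => ((A i + 1 : ℕ) : κ) * f (A + Finsupp.single i 1)

/-- The Jacobian ideal of the cleaned state. Mirror of the crux's `jac`. [cite: BoubakriGreuelMarkwig2010, §2] -/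
def jac (c : (Fin n → ℕ) → κ) : Ideal (MvPowerSeries (Fin n) κ) :=
  Ideal.span (Set.range (fun i => pd i (ser p c)))

/-- The TANGENT CONE datum `a_p`. Mirror of the crux's `cone`. [cite: Hironaka2003, §1] -/
def cone (c : (Fin n → ℕ) → κ) : MvPolynomial (Fin n) κ :=
  Finset.sum (Fintype.piFinset (fun _ : Fin n => Finset.range (p + 1))) (fun A => @ite (MvPolynomial (Fin n) κ) (Finset.sum Finset.univ (fun j => A j) = p) (Classical.dec _) (MvPolynomial.monomial (Finsupp.equivFunOnFinite.symm A) (clean p c A)) 0)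

/-- The CONE-INVARIANCE SPACE `L(a_p)`. Mirror of the crux's `Linv`. [cite: Hironaka1970AdditiveGroups, Thm 2] -/
def Linv (c : (Fin n → ℕ) → κ) : Set (Fin n → κ) :=
  {w : Fin n → κ | MvPolynomial.aeval (fun j : Fin n => (MvPolynomial.X (some j) : MvPolynomial (Option (Fin n)) κ) + MvPolynomial.C (w j) * MvPolynomial.X none) (cone p c) = MvPolynomial.rename some (cone p c) + MvPolynomial.C (MvPolynomial.eval w (cone p c)) * (MvPolynomial.X none) ^ p}

/-- `dL = dim span L(a_p)`. Mirror of the crux's `dL`. [cite: Hironaka1970AdditiveGroups, Thm 2] -/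
def dL (c : (Fin n → ℕ) → κ) : ℕ :=
  Module.finrank κ (Submodule.span κ (Linv p c))

end Calculus

/-- **The mirror is exact**: the route decl `ConeExit` is, definitionally, the following proposition
over the mirrored operators (its `let`-block ζ-reduces onto the `def`s above; the three predicates
`Isol`, `MultP`, `OrdP` of the crux are displayed inline). [folklore] -/
theorem crux_iff :
    ConeExit ↔
      ∀ p : ℕ, p.Prime → p ≠ 2 → ∀ n : ℕ, 3 ≤ n → ∀ (κ : Type) [Field κ] [CharP κ p] [PerfectField κ]
        (c : (Fin n → ℕ) → κ) (i : Fin n) (τ : Fin n → κ),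
        Module.Finite κ (MvPowerSeries (Fin n) κ ⧸ jac p c) →
        ((∃ A, clean p c A ≠ 0) ∧ ∀ A, clean p c A ≠ 0 → p ≤ Finset.sum Finset.univ (fun j => A j)) →
        Module.Finite κ (MvPowerSeries (Fin n) κ ⧸ jac p (step p i τ c)) →
        ((∃ A, clean p (step p i τ c) A ≠ 0) ∧
          ∀ A, clean p (step p i τ c) A ≠ 0 → p ≤ Finset.sum Finset.univ (fun j => A j)) →
        (∃ A, clean p c A ≠ 0 ∧ Finset.sum Finset.univ (fun j => A j) = p) ∧ dL p c = 1 :=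
  Iff.rfl

/-! ## A kernel-checkable certificate format for `Isol`: powers of the variables in the ideal -/

section Finiteness

variable {n : ℕ} {κ : Type} [Field κ]

open MvPowerSeries

/-- Truncation of a power series to the exponents `A` with `A j < N` for all `j < k`. [folklore] -/
def truncBelow (N k : ℕ) (f : MvPowerSeries (Fin n) κ) : MvPowerSeries (Fin n) κ :=
  show MvPowerSeries (Fin n) κ from
    fun A : Fin n →₀ ℕ => if ∀ j : Fin n, (j : ℕ) < k → A j < N then f A else 0

/-- The slice removed between stages `k` and `k + 1`, already divided by `X_k ^ N`. [folklore] -/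
def sliceAt (N : ℕ) (k : Fin n) (f : MvPowerSeries (Fin n) κ) : MvPowerSeries (Fin n) κ :=
  show MvPowerSeries (Fin n) κ from
    fun B : Fin n →₀ ℕ => if ∀ j : Fin n, (j : ℕ) < k → B j < N then f (B + Finsupp.single k N) else 0

omit [Field κ] in
/-- Coefficients of the truncation. [folklore] -/
lemma coeff_truncBelow [Field κ] (N k : ℕ) (f : MvPowerSeries (Fin n) κ) (A : Fin n →₀ ℕ) :
    coeff A (truncBelow N k f) = if ∀ j : Fin n, (j : ℕ) < k → A j < N then coeff A f else 0 := rfl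

omit [Field κ] in
/-- Coefficients of the slice. [folklore] -/
lemma coeff_sliceAt [Field κ] (N : ℕ) (k : Fin n) (f : MvPowerSeries (Fin n) κ) (B : Fin n →₀ ℕ) :
    coeff B (sliceAt N k f) =
      if ∀ j : Fin n, (j : ℕ) < k → B j < N then coeff (B + Finsupp.single k N) f else 0 := rfl

/-- One telescoping step: `trunc_k f - trunc_{k+1} f = X_k ^ N · slice_k f`. [folklore] -/
lemma truncBelow_sub_succ (N : ℕ) (k : Fin n) (f : MvPowerSeries (Fin n) κ) :
    truncBelow N k f - truncBelow N (k + 1) f = X k ^ N * sliceAt N k f := by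
  ext A
  rw [map_sub, coeff_truncBelow, coeff_truncBelow, X_pow_eq, coeff_monomial_mul, coeff_sliceAt,
    one_mul]
  have hsucc : (∀ j : Fin n, (j : ℕ) < (k : ℕ) + 1 → A j < N) ↔
      (∀ j : Fin n, (j : ℕ) < k → A j < N) ∧ A k < N := by
    constructor
    · intro h
      exact ⟨fun j hj => h j (by omega), h k (by omega)⟩
    · rintro ⟨h, hk⟩ j hj
      rcases Nat.lt_succ_iff_lt_or_eq.mp hj with hj' | hj'
      · exact h j hj'
      · have : j = k := Fin.ext hj'
        subst this
        exact hk
  by_cases hP : ∀ j : Fin n, (j : ℕ) < k → A j < N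
  · by_cases hk : N ≤ A k
    · -- the slice case
      have hns : ¬ (∀ j : Fin n, (j : ℕ) < (k : ℕ) + 1 → A j < N) := fun h => by
        have := (hsucc.mp h).2; omega
      rw [if_pos hP, if_neg hns, sub_zero, if_pos (Finsupp.single_le_iff.mpr hk)]
      have hP' : ∀ j : Fin n, (j : ℕ) < k → (A - Finsupp.single k N) j < N := by
        intro j hj
        have hjk : j ≠ k := fun h => by subst h; omega
        rw [Finsupp.tsub_apply, Finsupp.single_apply, if_neg (Ne.symm hjk), Nat.sub_zero]
        exact hP j hj
      rw [if_pos hP', tsub_add_cancel_of_le (Finsupp.single_le_iff.mpr hk)]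
    · have hs : ∀ j : Fin n, (j : ℕ) < (k : ℕ) + 1 → A j < N := hsucc.mpr ⟨hP, by omega⟩
      rw [if_pos hP, if_pos hs, sub_self, if_neg (fun h => hk (Finsupp.single_le_iff.mp h))]
  · have hns : ¬ (∀ j : Fin n, (j : ℕ) < (k : ℕ) + 1 → A j < N) := fun h => hP (hsucc.mp h).1
    rw [if_neg hP, if_neg hns, sub_zero]
    by_cases hk : N ≤ A k
    · rw [if_pos (Finsupp.single_le_iff.mpr hk)]
      have hP' : ¬ ∀ j : Fin n, (j : ℕ) < k → (A - Finsupp.single k N) j < N := by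
        intro h
        apply hP
        intro j hj
        have hjk : j ≠ k := fun h => by subst h; omega
        have := h j hj
        rwa [Finsupp.tsub_apply, Finsupp.single_apply, if_neg (Ne.symm hjk), Nat.sub_zero] at this
      rw [if_neg hP']
    · rw [if_neg (fun h => hk (Finsupp.single_le_iff.mp h))]

/-- The fully truncated series differs from `f` by an element of any ideal containing all `X_k ^ N`.
[folklore] -/
lemma sub_truncBelow_mem (J : Ideal (MvPowerSeries (Fin n) κ)) (N : ℕ)
    (hX : ∀ k : Fin n, X k ^ N ∈ J) (f : MvPowerSeries (Fin n) κ) :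
    ∀ k : ℕ, k ≤ n → f - truncBelow N k f ∈ J := by
  intro k
  induction k with
  | zero =>
    intro _
    have : truncBelow N 0 f = f := by
      ext A; rw [coeff_truncBelow, if_pos (fun j hj => absurd hj (Nat.not_lt_zero _))]
    rw [this, sub_self]
    exact J.zero_mem
  | succ k ih =>
    intro hk
    have hkn : k < n := hk
    have : f - truncBelow N (k + 1) f =
        (f - truncBelow N k f) + (truncBelow N k f - truncBelow N (k + 1) f) := by ring
    rw [this]
    refine J.add_mem (ih hkn.le) ?_
    have h := truncBelow_sub_succ N ⟨k, hkn⟩ f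
    simp only [] at h
    rw [h]
    exact Ideal.mul_mem_right _ _ (hX ⟨k, hkn⟩)

/-- The fully truncated series is a finite combination of the monomials with all exponents `< N`.
[folklore] -/
lemma truncBelow_eq_sum (N : ℕ) (f : MvPowerSeries (Fin n) κ) :
    truncBelow N n f =
      ∑ e : Fin n → Fin N, monomial (Finsupp.equivFunOnFinite.symm (fun j => (e j : ℕ)))
        (coeff (Finsupp.equivFunOnFinite.symm (fun j => (e j : ℕ))) f) := by
  ext A
  rw [coeff_truncBelow, map_sum]
  simp only [coeff_monomial]
  by_cases hP : ∀ j : Fin n, (j : ℕ) < n → A j < N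
  · rw [if_pos hP]
    have hA : ∀ j : Fin n, A j < N := fun j => hP j j.isLt
    let e₀ : Fin n → Fin N := fun j => ⟨A j, hA j⟩
    have hAe : Finsupp.equivFunOnFinite.symm (fun j => ((e₀ j : Fin N) : ℕ)) = A := by
      ext j; simp [e₀]
    rw [Finset.sum_eq_single e₀, if_pos hAe.symm, hAe]
    · intro e _ hne
      rw [if_neg]
      intro hEq
      apply hne
      funext j
      have h1 := congrArg (fun B : Fin n →₀ ℕ => B j) hEq
      simp only [Finsupp.coe_equivFunOnFinite_symm] at h1
      exact Fin.ext (by rw [← h1])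
    · intro h; exact absurd (Finset.mem_univ _) h
  · rw [if_neg hP]
    symm
    apply Finset.sum_eq_zero
    intro e _
    rw [if_neg]
    intro hEq
    apply hP
    intro j _
    rw [hEq]
    show (Finsupp.equivFunOnFinite.symm _) j < N
    rw [Finsupp.coe_equivFunOnFinite_symm]
    exact (e j).isLt

/-- **Certificate format for `Isol`.** If every `X_k ^ N` lies in the ideal `J ⊆ κ[[X₁ … Xₙ]]`, then
`κ[[X]] ⧸ J` is a finite `κ`-module (spanned by the monomials with all exponents `< N`). [folklore] -/
theorem module_finite_quotient_of_X_pow_mem (J : Ideal (MvPowerSeries (Fin n) κ)) (N : ℕ)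
    (hX : ∀ k : Fin n, X k ^ N ∈ J) : Module.Finite κ (MvPowerSeries (Fin n) κ ⧸ J) := by
  let E : (Fin n → Fin N) → (Fin n →₀ ℕ) := fun e => Finsupp.equivFunOnFinite.symm (fun j => (e j : ℕ))
  let S : Set (MvPowerSeries (Fin n) κ ⧸ J) := Set.range (fun e => Ideal.Quotient.mk J (monomial (E e) (1 : κ)))
  refine ⟨Submodule.fg_def.mpr ⟨S, Set.finite_range _, ?_⟩⟩
  rw [eq_top_iff]
  rintro x -
  obtain ⟨f, rfl⟩ := Ideal.Quotient.mk_surjective x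
  have hf : Ideal.Quotient.mk J f = Ideal.Quotient.mk J (truncBelow N n f) := by
    rw [Ideal.Quotient.eq]
    exact sub_truncBelow_mem J N hX f n le_rfl
  rw [hf, truncBelow_eq_sum, ← Ideal.Quotient.mkₐ_eq_mk κ, map_sum]
  refine Submodule.sum_mem _ (fun e _ => ?_)
  have hmono : monomial (E e) (coeff (E e) f) = coeff (E e) f • monomial (E e) (1 : κ) := by
    rw [← LinearMap.map_smul, smul_eq_mul, mul_one]
  rw [hmono, map_smul]
  exact Submodule.smul_mem _ _ (Submodule.subset_span ⟨e, rfl⟩)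

end Finiteness

/-! ## Two general facts about the calculus -/

section General

variable {n : ℕ} {κ : Type} [Field κ]

/-- Translating by `τ = 0` is the identity (only `D = 0` survives `0 ^ (D j)`). [folklore] -/
lemma tr_zero (i : Fin n) (s : ℕ) (c : (Fin n → ℕ) → κ) : tr i (0 : Fin n → κ) s c = c := by
  funext B
  unfold tr
  rw [Finset.sum_eq_single (0 : Fin n → ℕ)]
  · rw [if_pos (show (0 : Fin n → ℕ) i = 0 from rfl), add_zero, Finset.prod_eq_one, mul_one]
    intro j _
    simp
  · intro D _ hD
    by_cases hDi : D i = 0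
    · rw [if_pos hDi]
      obtain ⟨j, hj⟩ : ∃ j, D j ≠ 0 := by
        by_contra hcon
        push Not at hcon
        exact hD (funext hcon)
      have hji : j ≠ i := fun hji => hj (hji ▸ hDi)
      rw [Finset.prod_eq_zero (Finset.mem_erase.mpr ⟨hji, Finset.mem_univ j⟩), mul_zero]
      simp [zero_pow hj]
    · rw [if_neg hDi]
  · intro h
    exact absurd (Fintype.mem_piFinset.mpr fun j => Finset.mem_range.mpr (Nat.succ_pos _)) h

/-- The coefficients of the cleaned state. [folklore] -/
lemma coeff_ser (p : ℕ) (c : (Fin n → ℕ) → κ) (A : Fin n →₀ ℕ) :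
    MvPowerSeries.coeff A (ser p c) = clean p c A :=
  rfl

/-- The coefficients of `∂_k` of the cleaned state. [folklore] -/
lemma coeff_pd_ser (p : ℕ) (k : Fin n) (c : (Fin n → ℕ) → κ) (A : Fin n →₀ ℕ) :
    MvPowerSeries.coeff A (pd k (ser p c)) =
      ((A k + 1 : ℕ) : κ) * MvPowerSeries.coeff (A + Finsupp.single k 1) (ser p c) :=
  rfl

end General

end Summit.ResolutionOfSingularities.ResolutionOfSingularities.Theorems.ConeExit.Negative

end
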